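import Summits.AtomisticToContinuum.FouriersLaw.Theses.OddSectorIrreversibility
import Summits.AtomisticToContinuum.FouriersLaw.Theorems.OddSectorIrreversibilityOddResponseBoundDensityUnique
import Literature.MathematicalPhysics.KineticTheory.LangevinChainGibbs

/-!
# OddResponseBound — the corrected namesake: the cone-scale corrector bound makes the odd response INTENSIVE

Helper file for item stmt-AtomisticToContinuum-9140 (`OddSectorIrreversibility.OddResponseBound`, "SI":
`N · ∫ (h − h∘Θ)² dμ_{N,T,T} ≤ C` for the `L²` linear-response density `h` of `δ ↦ μ_{N,T+δ/2,T−δ/2}`).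
Sorry-free, no new definitions.

SI as filed carries the normalisation `N¹`; the route's own autopsy (rev 4 thesis; crux dossier
`Cruxes/OddResponseBound/Disproof.lean` §3; twin-history numerics kit j008646: `a_N := N∫(h−hΘ)² = 25/100/375`
at `N = 8/16/32`) puts the odd response of a deterministic conductor at `∫ (h − h∘Θ)² ≍ 1`, i.e. `a_N ≍ N`.
The statement the thesis keeps ("the namesake survives, corrected: E1 + OddDensityIsCorrector ⇒
sup_N ∫(h_N − h_N∘Θ)² dπ < ∞ — the static arrow of time of a deterministic Fourier conductor is INTENSIVE")
is SI with the factor `(N : ℝ) *` deleted. This file types that corrected statement (verbatim SI minus the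
factor, written out in the theorem types — no `def`) and proves:

* `oddResponseIntensive_of_coneScaleCorrector` — **crux E1 (`ConeScaleCorrector`) + support
  `OddDensityIsCorrector` ⇒ the intensive bound**, with the explicit constant `16 · max C₁ 0 / T⁴`
  (`C₁` = E1's constant): under the uniqueness antecedent `μ_{N,T,T}` is the Gibbs measure `π`
  (`pinnedChain_isSteadyState_gibbsMeasure`); E1's unnormalised weight `μ_T = e^{−H/T}dx` is `Z • π`, so
  a.e.-limits transfer and `∫ u² dπ ≤ C₁ N²`; `π` is `Θ`-invariant, so `∫ (u − u∘Θ)² dπ ≤ 4 C₁ N²`; and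
  `h − h∘Θ = (u − u∘Θ)/((N−1)T²)` a.e. gives `∫ (h − h∘Θ)² dπ ≤ 4 C₁ N² / ((N−1)² T⁴) ≤ 16 C₁ / T⁴` (`N ≥ 2`).
* `coneScaleCorrector_iff_gibbsForm` — E1 in either normalisation (`μ_T = e^{−H/T}dx` with `C N² Z` ⇔ Gibbs
  probability measure with `C N²`), the form in which the tree's fixed-`N` tools and the echo floor are written.
* `oddResponseIntensive_of_oddResponseBound` — the corrected statement is WEAKER than SI as filed
  (`∫ ≤ C/N ≤ C` for `N ≥ 2`), so the `a_N ≍ N` witness of the dossier misses it.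
* bookkeeping used by both lanes of the item: `withDensity_gibbs_eq_smul_gibbsMeasure`
  (`e^{−H/T}dx = (∫e^{−H/T}) • gibbsMeasure` for the pinned chain), the transfer lemmas
  `ae_smul_iff'`, `integral_eq_toReal_mul_of_eq_smul`, `memLp_iff_of_eq_smul`, and
  `integral_sub_comp_sq_le` (`∫ (u − u∘Θ)² ≤ 4 ∫ u²` for a `Θ`-invariant measure); `Θ`-invariance of
  the Gibbs measure is `DensityUnique.measurePreserving_momentumReversal_gibbsMeasure`.

Nothing here closes an item.
-/

noncomputable section

open MeasureTheory Filter Topology Set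
open Literature.MathematicalPhysics.KineticTheory.HeatConduction
open Summit.AtomisticToContinuum.FouriersLaw.Theses.OddSectorIrreversibility
open Summit.AtomisticToContinuum.FouriersLaw.Theorems.OddResponseBound.Negative
open Summit.AtomisticToContinuum.FouriersLaw.Theorems.OddResponseBound

namespace Summit.AtomisticToContinuum.FouriersLaw.Theorems.OddResponseBound.Intensive

/-! ## §1 scalar multiples of a measure: a.e., integrals, `L²` -/

section Smul

variable {X : Type*} [MeasurableSpace X] {μT π : Measure X} {c : ENNReal}

/-- If `μT = c • π` with `c ≠ 0` then `μT` and `π` have the same null sets. [folklore] -/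
theorem ae_smul_iff' (h : μT = c • π) (hc : c ≠ 0) {p : X → Prop} :
    (∀ᵐ x ∂μT, p x) ↔ ∀ᵐ x ∂π, p x := by
  rw [h]
  exact Measure.ae_ennreal_smul_measure_iff hc

/-- If `μT = c • π` then `∫ f dμT = c.toReal · ∫ f dπ`. [folklore] -/
theorem integral_eq_toReal_mul_of_eq_smul (h : μT = c • π) (f : X → ℝ) :
    ∫ x, f x ∂μT = c.toReal * ∫ x, f x ∂π := by
  rw [h, integral_smul_measure, smul_eq_mul]

/-- If `μT = c • π` with `c ≠ 0, ∞` then `L^p(μT) = L^p(π)`. [folklore] -/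
theorem memLp_iff_of_eq_smul (h : μT = c • π) (hc : c ≠ 0) (hc' : c ≠ ⊤) {f : X → ℝ} {p : ENNReal} :
    MemLp f p μT ↔ MemLp f p π := by
  constructor
  · intro hf
    have h2 : MemLp f p (c⁻¹ • μT) := hf.smul_measure (ENNReal.inv_ne_top.mpr hc)
    rwa [h, smul_smul, ENNReal.inv_mul_cancel hc hc', one_smul] at h2
  · intro hf
    rw [h]
    exact hf.smul_measure hc'

end Smul

/-! ## §2 the unnormalised Gibbs weight of the pinned chain is `Z •` the Gibbs measure -/

section Gibbs

variable {ω₂ lam β : ℝ}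

/-- For the pinned chain (`ω₂ > 0`, `lam, β ≥ 0`, any `γ`, `T > 0`): `Z := ∫ e^{−H_N/T} dq dp > 0`.
[folklore] -/
theorem integral_gibbsWeight_pos (hω : 0 < ω₂) (hl : 0 ≤ lam) (hβ : 0 ≤ β) (γ : ℝ) (N : ℕ) {T : ℝ}
    (hT : 0 < T) :
    0 < ∫ x, Real.exp (-((pinnedChain ω₂ lam β γ).hamiltonian N x) / T) :=
  integral_exp_pos (pinnedChain_integrable_gibbsDensity hω hl hβ γ N hT)

/-- **`e^{−H/T} dx = Z • gibbsMeasure`** for the pinned chain (`ω₂ > 0`, `lam, β ≥ 0`, any `γ`,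
`T > 0`), `Z = ∫ e^{−H/T}`: the unnormalised Gibbs weight of the route's cruxes (`ConeScaleCorrector`,
`SubBallisticWindow`, …) versus the tree's normalised `OscillatorChain.gibbsMeasure`
(`gibbsMeasure_eq_smul_withDensity`, `partitionFunction_eq_ofReal_integral`). [folklore] -/
theorem withDensity_gibbs_eq_smul_gibbsMeasure (hω : 0 < ω₂) (hl : 0 ≤ lam) (hβ : 0 ≤ β) (γ : ℝ)
    (N : ℕ) {T : ℝ} (hT : 0 < T) :
    (volume : Measure (PhaseSpace N)).withDensity
        (fun x => ENNReal.ofReal (Real.exp (-((pinnedChain ω₂ lam β γ).hamiltonian N x) / T))) =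
      ENNReal.ofReal (∫ x, Real.exp (-((pinnedChain ω₂ lam β γ).hamiltonian N x) / T)) •
        (pinnedChain ω₂ lam β γ).gibbsMeasure N T := by
  set P := pinnedChain ω₂ lam β γ with hP
  have hint : Integrable (P.gibbsDensity N T) := pinnedChain_integrable_gibbsDensity hω hl hβ γ N hT
  have hpos : 0 < ∫ x, P.gibbsDensity N T x := integral_exp_pos hint
  have e : (fun x => ENNReal.ofReal (Real.exp (-(P.hamiltonian N x) / T))) =
      fun x => ENNReal.ofReal (P.gibbsDensity N T x) := rfl
  have e' : (∫ x, Real.exp (-(P.hamiltonian N x) / T)) = ∫ x, P.gibbsDensity N T x := rfl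
  rw [e, e', P.gibbsMeasure_eq_smul_withDensity hint, P.partitionFunction_eq_ofReal_integral hint,
    smul_smul, ENNReal.mul_inv_cancel (ENNReal.ofReal_pos.mpr hpos).ne' ENNReal.ofReal_ne_top,
    one_smul]

end Gibbs

/-! ## §3 the odd part costs at most a factor 4 in `L²` -/

section Odd

variable {N : ℕ}

/-- For a momentum-reversal-invariant measure `π` and `u ∈ L²(π)`:
`∫ (u − u∘Θ)² dπ ≤ 4 ∫ u² dπ` (`(a−b)² ≤ 2a² + 2b²` and `∫ (u∘Θ)² = ∫ u²`). [folklore] -/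
theorem integral_sub_comp_sq_le {π : Measure (PhaseSpace N)}
    (hΘ : MeasurePreserving (momentumReversal N) π π) {u : PhaseSpace N → ℝ} (hu : MemLp u 2 π) :
    ∫ x, (u x - u (x.1, -x.2)) ^ 2 ∂π ≤ 4 * ∫ x, (u x) ^ 2 ∂π := by
  have huΘ : MemLp (fun x : PhaseSpace N => u (x.1, -x.2)) 2 π := by
    simpa only [Function.comp_def, momentumReversal_apply] using hu.comp_measurePreserving hΘ
  have h1 : Integrable (fun x => (u x) ^ 2) π := hu.integrable_sq
  have h2 : Integrable (fun x => (u (x.1, -x.2)) ^ 2) π := huΘ.integrable_sq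
  have hΘint : ∫ x, (u (x.1, -x.2)) ^ 2 ∂π = ∫ x, (u x) ^ 2 ∂π := by
    simpa only [momentumReversal_apply] using
      hΘ.integral_comp' (f := momentumReversal N) (fun x => (u x) ^ 2)
  calc ∫ x, (u x - u (x.1, -x.2)) ^ 2 ∂π
      ≤ ∫ x, (2 * (u x) ^ 2 + 2 * (u (x.1, -x.2)) ^ 2) ∂π := by
        refine integral_mono_of_nonneg (Eventually.of_forall fun x => sq_nonneg _)
          ((h1.const_mul 2).add (h2.const_mul 2)) (Eventually.of_forall fun x => ?_)
        nlinarith [sq_nonneg (u x + u (x.1, -x.2))]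
    _ = 2 * ∫ x, (u x) ^ 2 ∂π + 2 * ∫ x, (u (x.1, -x.2)) ^ 2 ∂π := by
        rw [integral_add (h1.const_mul 2) (h2.const_mul 2), integral_const_mul, integral_const_mul]
    _ = 4 * ∫ x, (u x) ^ 2 ∂π := by rw [hΘint]; ring

end Odd

/-! ## §4 E1 + OddDensityIsCorrector ⇒ the odd response is intensive -/

section Main

variable {ω₂ lam β γ : ℝ}

/-- **E1 in probability normalisation.** `ConeScaleCorrector` (stated against the unnormalised weight
`μ_T = e^{−H/T}dx` and its mass `Z`) gives, for all parameters `> 0` and `T > 0`, a constant `C₁` with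
`u ∈ L²(π)` and `∫ u² dπ ≤ C₁ N²` for every `N` and every `π`-a.e. limit `u` of the finite-horizon Kubo
correctors, `π = gibbsMeasure N T` (same null sets as `μ_T`; `∫ · dμ_T = Z ∫ · dπ`). [folklore] -/
theorem corrector_normSq_le_of_coneScaleCorrector (hE1 : ConeScaleCorrector) (hω : 0 < ω₂) (hl : 0 < lam)
    (hβ : 0 < β) (hγ : 0 < γ) {T : ℝ} (hT : 0 < T) :
    ∃ C₁ : ℝ, ∀ (N : ℕ) (u : PhaseSpace N → ℝ),
      (∀ᵐ x ∂((pinnedChain ω₂ lam β γ).gibbsMeasure N T), Tendsto (fun τ : ℝ => ∫ t in Set.Ioc (0 : ℝ) τ,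
          (∫ y, (∑ i : Fin N, (pinnedChain ω₂ lam β γ).bondCurrent N i y)
            ∂((pinnedChain ω₂ lam β γ).transitionKernel N T T t.toNNReal x))) atTop (𝓝 (u x))) →
      MemLp u 2 ((pinnedChain ω₂ lam β γ).gibbsMeasure N T) ∧
        ∫ x, (u x) ^ 2 ∂((pinnedChain ω₂ lam β γ).gibbsMeasure N T) ≤ C₁ * (N : ℝ) ^ 2 := by
  obtain ⟨C₁, hC₁⟩ := hE1 ω₂ lam β γ hω hl hβ hγ T hT
  refine ⟨C₁, fun N u hlim => ?_⟩
  set P := pinnedChain ω₂ lam β γ with hP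
  set Z : ℝ := ∫ x, Real.exp (-(P.hamiltonian N x) / T) with hZ
  have hZpos : 0 < Z := integral_gibbsWeight_pos hω hl.le hβ.le γ N hT
  have hsmul := withDensity_gibbs_eq_smul_gibbsMeasure hω hl.le hβ.le γ N hT
  have hc0 : ENNReal.ofReal Z ≠ 0 := (ENNReal.ofReal_pos.mpr hZpos).ne'
  have hlimT := (ae_smul_iff' hsmul hc0).mpr hlim
  have hE := hC₁ N u
  dsimp only at hE
  obtain ⟨hmem, hbound⟩ := hE hlimT
  refine ⟨(memLp_iff_of_eq_smul hsmul hc0 ENNReal.ofReal_ne_top).mp hmem, ?_⟩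
  rw [integral_eq_toReal_mul_of_eq_smul hsmul, ENNReal.toReal_ofReal hZpos.le] at hbound
  -- `Z · ∫ u² dπ ≤ C₁ N² Z` with `Z > 0`
  have : Z * ∫ x, (u x) ^ 2 ∂(P.gibbsMeasure N T) ≤ Z * (C₁ * (N : ℝ) ^ 2) := by
    calc Z * ∫ x, (u x) ^ 2 ∂(P.gibbsMeasure N T) ≤ C₁ * (N : ℝ) ^ 2 * Z := hbound
      _ = Z * (C₁ * (N : ℝ) ^ 2) := by ring
  exact le_of_mul_le_mul_left this hZpos

/-- **E1 in either normalisation.** `ConeScaleCorrector` (unnormalised weight `μ_T = e^{−H/T}dx`, bound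
`C·N²·Z`) is EQUIVALENT to the same statement over the Gibbs probability measure `π = gibbsMeasure N T` with
bound `C·N²` (`μ_T = Z • π`: same null sets, `∫ · dμ_T = Z ∫ · dπ`, `L²(μ_T) = L²(π)`). The `π`-form is the one
in which the tree's fixed-`N` tools are written (Harris bound `pinnedChain_harris_bound`, resolvent, Dynkin:
`…OddDensityIsCorrectorResolvent.lean`) and in which `Negative/EchoFloor.lean` states the echo floor. [folklore] -/
theorem coneScaleCorrector_iff_gibbsForm :
    ConeScaleCorrector ↔
    ∀ ω₂ lam β γ : ℝ, 0 < ω₂ → 0 < lam → 0 < β → 0 < γ → ∀ T : ℝ, 0 < T → ∃ C : ℝ,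
      ∀ (N : ℕ) (u : PhaseSpace N → ℝ),
      (∀ᵐ x ∂((pinnedChain ω₂ lam β γ).gibbsMeasure N T), Tendsto (fun τ : ℝ => ∫ t in Set.Ioc (0 : ℝ) τ,
          (∫ y, (∑ i : Fin N, (pinnedChain ω₂ lam β γ).bondCurrent N i y)
            ∂((pinnedChain ω₂ lam β γ).transitionKernel N T T t.toNNReal x))) atTop (𝓝 (u x))) →
      MemLp u 2 ((pinnedChain ω₂ lam β γ).gibbsMeasure N T) ∧
        ∫ x, (u x) ^ 2 ∂((pinnedChain ω₂ lam β γ).gibbsMeasure N T) ≤ C * (N : ℝ) ^ 2 := by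
  constructor
  · intro hE1 ω₂ lam β γ hω hl hβ hγ T hT
    exact corrector_normSq_le_of_coneScaleCorrector hE1 hω hl hβ hγ hT
  · intro hG ω₂ lam β γ hω hl hβ hγ T hT
    obtain ⟨C, hC⟩ := hG ω₂ lam β γ hω hl hβ hγ T hT
    refine ⟨C, fun N u => ?_⟩
    dsimp only
    intro hlim
    set P := pinnedChain ω₂ lam β γ with hP
    set Z : ℝ := ∫ x, Real.exp (-(P.hamiltonian N x) / T) with hZ
    have hZpos : 0 < Z := integral_gibbsWeight_pos hω hl.le hβ.le γ N hT
    have hsmul := withDensity_gibbs_eq_smul_gibbsMeasure hω hl.le hβ.le γ N hT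
    have hc0 : ENNReal.ofReal Z ≠ 0 := (ENNReal.ofReal_pos.mpr hZpos).ne'
    obtain ⟨hmem, hb⟩ := hC N u ((ae_smul_iff' hsmul hc0).mp hlim)
    refine ⟨(memLp_iff_of_eq_smul hsmul hc0 ENNReal.ofReal_ne_top).mpr hmem, ?_⟩
    rw [integral_eq_toReal_mul_of_eq_smul hsmul, ENNReal.toReal_ofReal hZpos.le]
    calc Z * ∫ x, (u x) ^ 2 ∂(P.gibbsMeasure N T) ≤ Z * (C * (N : ℝ) ^ 2) :=
          mul_le_mul_of_nonneg_left hb hZpos.le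
      _ = C * (N : ℝ) ^ 2 * Z := by ring

/-- **The corrected namesake of SI: E1 + OddDensityIsCorrector ⇒ the odd response is intensive.**
Assume crux `ConeScaleCorrector` (E1: `∫ u² dμ_T ≤ C₁ N² Z` for the Kubo corrector of the equilibrium open
chain) and support `OddDensityIsCorrector` (`h − h∘Θ = (u − u∘Θ)/((N−1)T²)` a.e.). Then for all parameters
`> 0`, under weak-NESS uniqueness, along every steady-state family `μ` and for every `T > 0` there is `C`
(namely `16 · max C₁ 0 / T⁴`) such that for all `N ≥ 2` and every `L²(μ_{N,T,T})` linear-response density `h`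
of `δ ↦ μ_{N,T+δ/2,T−δ/2}` (the predicate of `OddResponseBound`, verbatim):
`h − h∘Θ ∈ L²(μ_{N,T,T})` and `∫ (h − h∘Θ)² dμ_{N,T,T} ≤ C` — the statement `OddResponseBound` with the factor
`(N : ℝ) *` deleted ("sup_N ∫(h_N − h_N∘Θ)² dπ < ∞": the static arrow of time of the conductor is
INTENSIVE, `O(δ²)` nats). Proof: `μ_{N,T,T} = π :=` Gibbs (uniqueness + `pinnedChain_isSteadyState_gibbsMeasure`),
`∫ u² dπ ≤ C₁N²` (`corrector_normSq_le_of_coneScaleCorrector`), `∫ (u − u∘Θ)² dπ ≤ 4C₁N²` (`Θ`-invariance),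
`N² ≤ 4(N−1)²`. [folklore] -/
theorem oddResponseIntensive_of_coneScaleCorrector (hE1 : ConeScaleCorrector) (hO : OddDensityIsCorrector) :
    ∀ ω₂ lam β γ : ℝ, 0 < ω₂ → 0 < lam → 0 < β → 0 < γ →
    (∀ (N : ℕ) (T_L T_R : ℝ), 0 < T_L → 0 < T_R → ∀ μ ν : Measure (PhaseSpace N),
      (pinnedChain ω₂ lam β γ).IsSteadyState N T_L T_R μ →
      (pinnedChain ω₂ lam β γ).IsSteadyState N T_L T_R ν → μ = ν) →
    ∀ μ : (N : ℕ) → ℝ → ℝ → Measure (PhaseSpace N),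
    (∀ (N : ℕ) (T_L T_R : ℝ), 0 < T_L → 0 < T_R →
      (pinnedChain ω₂ lam β γ).IsSteadyState N T_L T_R (μ N T_L T_R)) →
    ∀ T : ℝ, 0 < T → ∃ C : ℝ, ∀ (N : ℕ) (h : PhaseSpace N → ℝ), 2 ≤ N →
    (MemLp h 2 (μ N T T) ∧
      (∀ F : PhaseSpace N → ℝ, ContDiff ℝ ((⊤ : ℕ∞) : WithTop ℕ∞) F → HasCompactSupport F →
        Tendsto (fun δ : ℝ => ((∫ x, F x ∂(μ N (T + δ / 2) (T - δ / 2))) - ∫ x, F x ∂(μ N T T)) / δ)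
          (𝓝[≠] 0) (𝓝 (∫ x, F x * h x ∂(μ N T T)))) ∧
      (∀ i : Fin N, Tendsto (fun δ : ℝ =>
          ((∫ x, (pinnedChain ω₂ lam β γ).bondCurrent N i x ∂(μ N (T + δ / 2) (T - δ / 2))) -
            ∫ x, (pinnedChain ω₂ lam β γ).bondCurrent N i x ∂(μ N T T)) / δ)
          (𝓝[≠] 0) (𝓝 (∫ x, (pinnedChain ω₂ lam β γ).bondCurrent N i x * h x ∂(μ N T T))))) →
    MemLp (fun x : PhaseSpace N => h x - h (x.1, -x.2)) 2 (μ N T T) ∧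
      ∫ x, (h x - h (x.1, -x.2)) ^ 2 ∂(μ N T T) ≤ C := by
  intro ω₂ lam β γ hω hl hβ hγ hUq μ hμ T hT
  obtain ⟨C₁, hC₁⟩ := corrector_normSq_le_of_coneScaleCorrector hE1 hω hl hβ hγ hT
  refine ⟨16 * max C₁ 0 / T ^ 4, fun N h hN2 hh => ?_⟩
  set P := pinnedChain ω₂ lam β γ with hP
  -- the equal-temperature member of the family is the Gibbs measure
  have hG : μ N T T = P.gibbsMeasure N T :=
    hUq N T T hT hT _ _ (hμ N T T hT hT) (pinnedChain_isSteadyState_gibbsMeasure hω hl.le hβ.le γ N hT)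
  have hΘ : MeasurePreserving (momentumReversal N) (P.gibbsMeasure N T) (P.gibbsMeasure N T) :=
    DensityUnique.measurePreserving_momentumReversal_gibbsMeasure P N T
  -- the corrector behind `h` (OddDensityIsCorrector) and its E1 bound
  obtain ⟨u, hu2, hlim, hident⟩ := hO ω₂ lam β γ hω hl hβ hγ hUq μ hμ T hT N h hN2 hh
  obtain ⟨hh2, -, -⟩ := hh
  rw [hG] at hu2 hlim hident hh2 ⊢
  obtain ⟨-, hubound⟩ := hC₁ N u hlim
  -- `L²` membership of the odd part of `h`
  have hhΘ : MemLp (fun x : PhaseSpace N => h (x.1, -x.2)) 2 (P.gibbsMeasure N T) := by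
    simpa only [Function.comp_def, momentumReversal_apply] using hh2.comp_measurePreserving hΘ
  refine ⟨hh2.sub hhΘ, ?_⟩
  -- `∫ (h − hΘ)² = ∫ (u − uΘ)² / ((N−1)T²)²`
  have hN2r : (2 : ℝ) ≤ N := by exact_mod_cast hN2
  have hK : 0 < ((N : ℝ) - 1) * T ^ 2 := by
    have : (0 : ℝ) < (N : ℝ) - 1 := by linarith
    positivity
  have heq : ∫ x, (h x - h (x.1, -x.2)) ^ 2 ∂(P.gibbsMeasure N T) =
      (∫ x, (u x - u (x.1, -x.2)) ^ 2 ∂(P.gibbsMeasure N T)) / (((N : ℝ) - 1) * T ^ 2) ^ 2 := by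
    rw [← integral_div]
    refine integral_congr_ae ?_
    filter_upwards [hident] with x hx
    rw [hx, div_pow]
  have hodd : ∫ x, (u x - u (x.1, -x.2)) ^ 2 ∂(P.gibbsMeasure N T) ≤ 4 * (max C₁ 0 * (N : ℝ) ^ 2) := by
    refine (integral_sub_comp_sq_le hΘ hu2).trans ?_
    have : C₁ * (N : ℝ) ^ 2 ≤ max C₁ 0 * (N : ℝ) ^ 2 :=
      mul_le_mul_of_nonneg_right (le_max_left _ _) (sq_nonneg _)
    linarith
  rw [heq, div_le_iff₀ (pow_pos hK 2)]
  refine hodd.trans ?_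
  -- `4 M N² ≤ (16 M / T⁴) · ((N−1)T²)²` since `N² ≤ 4 (N−1)²` for `N ≥ 2`
  have hM : 0 ≤ max C₁ 0 := le_max_right _ _
  have hT4 : 0 < T ^ 4 := by positivity
  have hNN : (N : ℝ) ^ 2 ≤ 4 * ((N : ℝ) - 1) ^ 2 := by nlinarith
  calc 4 * (max C₁ 0 * (N : ℝ) ^ 2) = 4 * max C₁ 0 * (N : ℝ) ^ 2 := by ring
    _ ≤ 4 * max C₁ 0 * (4 * ((N : ℝ) - 1) ^ 2) := mul_le_mul_of_nonneg_left hNN (by positivity)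
    _ = 16 * max C₁ 0 / T ^ 4 * (((N : ℝ) - 1) * T ^ 2) ^ 2 := by
        field_simp
        ring

/-- **The corrected statement is weaker than SI as filed**: `OddResponseBound` (with the factor `N`)
implies the intensive bound with the same constant (`0 ≤ N ∫ (h−hΘ)² ≤ C` forces `0 ≤ C`, and
`∫ ≤ C/N ≤ C` for `N ≥ 2`). So the dossier's witness `a_N = N∫(h−hΘ)² ≍ N` (Disproof.lean §3, kit j008646)
refutes SI but not its correction. [folklore] -/
theorem oddResponseIntensive_of_oddResponseBound (hSI : OddResponseBound) :
    ∀ ω₂ lam β γ : ℝ, 0 < ω₂ → 0 < lam → 0 < β → 0 < γ →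
    (∀ (N : ℕ) (T_L T_R : ℝ), 0 < T_L → 0 < T_R → ∀ μ ν : Measure (PhaseSpace N),
      (pinnedChain ω₂ lam β γ).IsSteadyState N T_L T_R μ →
      (pinnedChain ω₂ lam β γ).IsSteadyState N T_L T_R ν → μ = ν) →
    ∀ μ : (N : ℕ) → ℝ → ℝ → Measure (PhaseSpace N),
    (∀ (N : ℕ) (T_L T_R : ℝ), 0 < T_L → 0 < T_R →
      (pinnedChain ω₂ lam β γ).IsSteadyState N T_L T_R (μ N T_L T_R)) →
    ∀ T : ℝ, 0 < T → ∃ C : ℝ, ∀ (N : ℕ) (h : PhaseSpace N → ℝ), 2 ≤ N →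
    (MemLp h 2 (μ N T T) ∧
      (∀ F : PhaseSpace N → ℝ, ContDiff ℝ ((⊤ : ℕ∞) : WithTop ℕ∞) F → HasCompactSupport F →
        Tendsto (fun δ : ℝ => ((∫ x, F x ∂(μ N (T + δ / 2) (T - δ / 2))) - ∫ x, F x ∂(μ N T T)) / δ)
          (𝓝[≠] 0) (𝓝 (∫ x, F x * h x ∂(μ N T T)))) ∧
      (∀ i : Fin N, Tendsto (fun δ : ℝ =>
          ((∫ x, (pinnedChain ω₂ lam β γ).bondCurrent N i x ∂(μ N (T + δ / 2) (T - δ / 2))) -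
            ∫ x, (pinnedChain ω₂ lam β γ).bondCurrent N i x ∂(μ N T T)) / δ)
          (𝓝[≠] 0) (𝓝 (∫ x, (pinnedChain ω₂ lam β γ).bondCurrent N i x * h x ∂(μ N T T))))) →
    MemLp (fun x : PhaseSpace N => h x - h (x.1, -x.2)) 2 (μ N T T) ∧
      ∫ x, (h x - h (x.1, -x.2)) ^ 2 ∂(μ N T T) ≤ C := by
  intro ω₂ lam β γ hω hl hβ hγ hUq μ hμ T hT
  obtain ⟨C, hC⟩ := hSI ω₂ lam β γ hω hl hβ hγ hUq μ hμ T hT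
  refine ⟨C, fun N h hN2 hh => ?_⟩
  obtain ⟨hmem, hbound⟩ := hC N h hN2 hh
  refine ⟨hmem, ?_⟩
  have hI : 0 ≤ ∫ x, (h x - h (x.1, -x.2)) ^ 2 ∂(μ N T T) := integral_nonneg fun x => sq_nonneg _
  have hN1 : (1 : ℝ) ≤ N := by exact_mod_cast (le_trans (by norm_num) hN2)
  nlinarith

end Main

end Summit.AtomisticToContinuum.FouriersLaw.Theorems.OddResponseBound.Intensive
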